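import Literature.NumberTheory.EllipticCurves.PastenValuationProductThm115Proofs
import Literature.NumberTheory.EllipticCurves.MatsunoCurvesRankProofs
import Literature.NumberTheory.DiophantineGeometry.TameAdditiveTypesAtTwoProofs
import Summits.BirchSwinnertonDyer.BirchSwinnertonDyer.Theorems.CongruentShaFreeCutKatoKummerLogTorsion
import Literature.NumberTheory.EllipticCurves.PadicFiltrationIndexProofs
import Literature.NumberTheory.EllipticCurves.TamagawaSubgroupProofs
import Summits.BirchSwinnertonDyer.Rank1Residual.Additive.LocalLogImageRat
import Summits.BirchSwinnertonDyer.Rank1Residual.Additive.LocalTorsionExponent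
import HarnessLib

/-!
# `kato_Fframe_r4` — width stub S2″ PROVED from tree theorems (crux workfile, NOT a registration)

Sorry-free proof of the statement of `stub_tateUniformisationLogMinimumTamagawa` (S2″,
`Lines/kato_Fframe_r4.lean` rev 4 f94d5116aef1b815, l.281), verbatim, in the sibling namespace
`…KatoFframe.S2split`, so that a width prover can lift it into `Theorems/` unchanged and discharge `hS2`
of `EulerHalfNotRamNoInertSetAtFive_of` on the 370 split pairs.
Chain (memo `Lines/kato_Fframe_r4_S2proofs.md` §2): (a) Kodaira–Néron split `c_p = ord_p(Δ_min)`
(`localTamagawaNumber_padic_eq_of_split` + `ordMinimalDiscriminant_eq_padic` +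
`ordMinimalDiscriminant_eq_padicValInt_natGenerator'`); (b) the image of `log` on `E(ℚ_p)` is
`p^{1+t−v_p c_p} ℤ_p` (`range_padicLog_baseChange_of_mult`, `padicLogLocal_eq_padicLog`); (c) `E(ℚ_p)[p^∞]`
is CYCLIC at split multiplicative `p ≥ 3` — it meets `E₀(ℚ_p)` trivially (`E₁` torsion-free, `p ∤ #Ẽ_ns(𝔽_p)`)
and `E(ℚ_p)/E₀(ℚ_p)` is cyclic (`isAddCyclic_quotient_goodReductionSubgroup_of_hasSplitMultiplicativeReduction`) —
so a point of order exactly `p^t` exists. Author: planner-bsd-idea-9 g39 (ideator; W-79: unregistered; no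
proposal). No summit statement / crux proved; BSD proved for no curve.
[cite: SilvermanAEC2009, IV.6.4, VII.2.1, VII.3.1, VII.6.1] [cite: SilvermanATAEC1994, Cor. IV.9.2(d) with (b) (PDF p. 340)]
-/

noncomputable section

open scoped Classical

set_option linter.dupNamespace false

namespace Summit.BirchSwinnertonDyer.BirchSwinnertonDyer.Cruxes.EulerHalfNotRamNoInertSetAtFive.KatoFframe.S2split

open WeierstrassCurve IsDedekindDomain NumberField
open Literature.NumberTheory.EllipticCurves Literature.NumberTheory.EllipticCurves.Kato2004
open Literature.NumberTheory.EllipticCurves.Rank1Residual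
open Summit.BirchSwinnertonDyer.Rank1Residual
open Summit.BirchSwinnertonDyer.Rank1Residual.X11b
open Summit.BirchSwinnertonDyer.Rank1Residual.Additive
open Summit.BirchSwinnertonDyer.BirchSwinnertonDyer.Theorems.CongruentShaFreeCutKatoKummerLogTorsion

/-! ## (a) Kodaira–Néron, split: `c_p(E ⊗ ℚ_p) = ord_p(Δ_min)` -/

/-- **`c_p = ord_p(Δ_min)` at a SPLIT multiplicative prime**, `p`-adic currency: the Tamagawa number of
`W ⊗ ℚ_p` is the `p`-adic valuation of the minimal discriminant of the globally minimal `W`.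
[cite: SilvermanATAEC1994, Cor. IV.9.2(d) with (b) (PDF p. 340)] [cite: SilvermanAEC2009, VIII.8] -/
theorem localTamagawaNumber_padic_eq_padicValInt_of_split (W : WeierstrassCurve ℚ) [W.IsElliptic]
    [W.IsGloballyMinimal] (p : ℕ) [Fact p.Prime] (hsplit : W.HasSplitMultiplicativeReductionAtPrime p) :
    (W.baseChange ℚ_[p]).localTamagawaNumber ℤ_[p] = padicValInt p W.minimalDiscriminantInt := by
  obtain ⟨v, hv⟩ : ∃ v : HeightOneSpectrum ℤ,
      ((Rat.HeightOneSpectrum.primesEquiv (R := ℤ) v : Nat.Primes) : ℕ) = p :=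
    ⟨(Rat.HeightOneSpectrum.primesEquiv (R := ℤ)).symm ⟨p, Fact.out⟩,
      congrArg Subtype.val ((Rat.HeightOneSpectrum.primesEquiv (R := ℤ)).apply_symm_apply _)⟩
  subst hv
  have hs : ((W.baseChange ℚ_[(Rat.HeightOneSpectrum.primesEquiv (R := ℤ) v : ℕ)]).minimal
      ℤ_[(Rat.HeightOneSpectrum.primesEquiv (R := ℤ) v : ℕ)]).HasSplitMultiplicativeReduction
      ℤ_[(Rat.HeightOneSpectrum.primesEquiv (R := ℤ) v : ℕ)] := hsplit
  rw [localTamagawaNumber_padic_eq_of_split _ _ hs, ← W.ordMinimalDiscriminant_eq_padic v,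
    W.ordMinimalDiscriminant_eq_padicValInt_natGenerator' v]
  rfl

/-! ## (c) `E(ℚ_p)[p^∞]` is cyclic at split multiplicative reduction -/

section Local

variable {p : ℕ} [hp : Fact p.Prime] (X : WeierstrassCurve ℚ_[p]) [X.IsMinimal ℤ_[p]] [X.IsElliptic]

/-- **`E₀(ℚ_p) ∩ E(ℚ_p)[p^∞] = 0`** for a minimal equation with `p ≥ 3` and `p ∤ #Ẽ_ns(𝔽_p)`:
`[E₀ : E₁] = #Ẽ_ns(𝔽_p)` kills `Q ∈ E₀` into the torsion-free `E₁(ℚ_p)`, so the order of a `p`-power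
torsion `Q ∈ E₀` divides both `#Ẽ_ns(𝔽_p)` and a power of `p`. [cite: SilvermanAEC2009, VII.2.1, VII.3.1] -/
theorem eq_zero_of_mem_goodReductionSubgroup_of_mem_primaryComponent (hp3 : 3 ≤ p)
    (hn : ¬ p ∣ Nat.card (X.reduction ℤ_[p]).toAffine.Point) {Q : X.toAffine.Point}
    (hQ0 : Q ∈ X.goodReductionSubgroup ℤ_[p])
    (hQp : Q ∈ AddCommGroup.primaryComponent X.toAffine.Point p) : Q = 0 := by
  set F := X.formalFiltration 0 with hF
  set E0 := X.goodReductionSubgroup ℤ_[p] with hE0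
  -- `E₁ ≤ E₀` (as in `KimAtThreeFineKatoSATPoints.formalFiltration_zero_le_goodReductionSubgroup`, any reduction type)
  have hle : F ≤ E0 := by
    obtain ⟨I, hI⟩ : ∃ I : WeierstrassCurve ℤ_[p], X = I.baseChange ℚ_[p] :=
      IsIntegral.integral (R := ℤ_[p]) (W := X)
    subst hI
    rw [hF, hE0, goodReductionSubgroup_baseChange_eq, ← kernelOfReduction_eq_formalFiltration_zero I]
    exact kernelOfReduction_le_nonsingularReductionSubgroup _
  -- `c_p ≠ 0`: `[E : E₁] = c_p · #Ẽ_ns` divides the finite non-zero `[E : E⁽²⁾]`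
  have hc : X.localTamagawaNumber ℤ_[p] ≠ 0 := by
    have h2 := LocalLog.index_formalFiltration_two_ne_zero X
    have hdvd : F.index ∣ (X.formalFiltration 2).index :=
      AddSubgroup.index_dvd_of_le (X.formalFiltration_antitone (show 0 ≤ 2 by norm_num))
    have h0 : F.index ≠ 0 := fun h => h2 (Nat.eq_zero_of_zero_dvd (h ▸ hdvd))
    rw [hF, LocalLog.index_formalFiltration_zero_eq X] at h0
    exact fun h => h0 (by rw [h, zero_mul])
  -- `[E₀ : E₁] = #Ẽ_ns(𝔽_p)`
  have hrel : F.relIndex E0 = Nat.card (X.reduction ℤ_[p]).toAffine.Point := by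
    have h := AddSubgroup.relIndex_mul_index hle
    rw [hE0, ← localTamagawaNumber_eq_index_goodReductionSubgroup (R := ℤ_[p]) X, hF,
      LocalLog.index_formalFiltration_zero_eq X] at h
    have h' : F.relIndex E0 * X.localTamagawaNumber ℤ_[p] =
        Nat.card (X.reduction ℤ_[p]).toAffine.Point * X.localTamagawaNumber ℤ_[p] := by
      rw [h, mul_comm]
    exact Nat.eq_of_mul_eq_mul_right (Nat.pos_of_ne_zero hc) h'
  -- `#Ẽ_ns • Q ∈ E₁`
  have hmem : (F.relIndex E0) • Q ∈ F := by
    have h := (F.addSubgroupOf E0).nsmul_index_mem ⟨Q, hQ0⟩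
    rw [AddSubgroup.mem_addSubgroupOf] at h
    exact h
  obtain ⟨k, hk⟩ := (AddCommGroup.mem_primaryComponent).mp hQp
  have hfin : IsOfFinAddOrder Q :=
    isOfFinAddOrder_iff_nsmul_eq_zero.mpr ⟨p ^ k, pow_pos hp.out.pos _, hk⟩
  have hzero : (F.relIndex E0) • Q = 0 :=
    LocalLog.eq_zero_of_isInReductionKernel_of_isOfFinAddOrder X hp3
      (X.mem_formalFiltration_zero_iff.mp hmem) hfin.nsmul
  have hd1 : addOrderOf Q ∣ Nat.card (X.reduction ℤ_[p]).toAffine.Point :=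
    hrel ▸ addOrderOf_dvd_iff_nsmul_eq_zero.mpr hzero
  have hd2 : addOrderOf Q ∣ p ^ k := addOrderOf_dvd_iff_nsmul_eq_zero.mpr hk
  have hcop : Nat.Coprime (p ^ k) (Nat.card (X.reduction ℤ_[p]).toAffine.Point) :=
    Nat.Coprime.pow_left k ((Nat.Prime.coprime_iff_not_dvd hp.out).mpr hn)
  have hd : addOrderOf Q ∣ 1 := hcop ▸ Nat.dvd_gcd hd2 hd1
  exact AddMonoid.addOrderOf_eq_one_iff.mp (Nat.dvd_one.mp hd)

/-- **`E(ℚ_p)[p^∞]` is CYCLIC at split multiplicative reduction** (`p ≥ 3`, `p ∤ #Ẽ_ns(𝔽_p)`): it embeds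
in `E(ℚ_p)/E₀(ℚ_p)`, which is cyclic by Kodaira–Néron (`ℤ_p` is Henselian).
[cite: SilvermanATAEC1994, Cor. IV.9.2(d) with (b) (PDF p. 340)] [cite: SilvermanAEC2009, VII.2.1, VII.3.1] -/
theorem isAddCyclic_primaryComponent_of_hasSplitMultiplicativeReduction (hp3 : 3 ≤ p)
    (hn : ¬ p ∣ Nat.card (X.reduction ℤ_[p]).toAffine.Point) (hs : X.HasSplitMultiplicativeReduction ℤ_[p]) :
    IsAddCyclic (AddCommGroup.primaryComponent X.toAffine.Point p) := by
  haveI := hs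
  haveI := X.isAddCyclic_quotient_goodReductionSubgroup_of_hasSplitMultiplicativeReduction ℤ_[p]
  set f : AddCommGroup.primaryComponent X.toAffine.Point p →+
      X.toAffine.Point ⧸ X.goodReductionSubgroup ℤ_[p] :=
    (QuotientAddGroup.mk' (X.goodReductionSubgroup ℤ_[p])).comp
      (AddCommGroup.primaryComponent X.toAffine.Point p).subtype with hf
  refine isAddCyclic_of_injective f ((injective_iff_map_eq_zero f).mpr fun a ha => ?_)
  have ha0 : (a : X.toAffine.Point) ∈ X.goodReductionSubgroup ℤ_[p] := by
    rw [hf, AddMonoidHom.comp_apply, AddSubgroup.subtype_apply, QuotientAddGroup.mk'_apply,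
      QuotientAddGroup.eq_zero_iff] at ha
    exact ha
  exact Subtype.ext
    (eq_zero_of_mem_goodReductionSubgroup_of_mem_primaryComponent X hp3 hn ha0 a.2)

/-- **A point of order exactly `p^t`, `t = v_p #E(ℚ_p)_tors`**, at split multiplicative reduction
(`p ≥ 3`, `p ∤ #Ẽ_ns(𝔽_p)`): a generator of the cyclic group `E(ℚ_p)[p^∞]` of order `p^t`.
[cite: SilvermanATAEC1994, Cor. IV.9.2(d)] [cite: SilvermanAEC2009, VII.3.1] -/
theorem exists_addOrderOf_eq_pow_padicValNat_card_torsion (hp3 : 3 ≤ p)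
    (hn : ¬ p ∣ Nat.card (X.reduction ℤ_[p]).toAffine.Point) (hs : X.HasSplitMultiplicativeReduction ℤ_[p]) :
    ∃ Q₀ : X.toAffine.Point,
      addOrderOf Q₀ = p ^ padicValNat p (Nat.card (AddCommGroup.torsion X.toAffine.Point)) := by
  haveI := isAddCyclic_primaryComponent_of_hasSplitMultiplicativeReduction X hp3 hn hs
  obtain ⟨g, hg⟩ :=
    IsAddCyclic.exists_ofOrder_eq_natCard (α := AddCommGroup.primaryComponent X.toAffine.Point p)
  refine ⟨g, ?_⟩
  rw [AddSubgroup.addOrderOf_coe, hg, LocalLog.natCard_primaryComponent_point_eq_pow X]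

end Local

/-! ## (a) + (b) + (c): the stub statement -/

/-- **S2″, PROVED** — the statement of `stub_tateUniformisationLogMinimumTamagawa` of
`Lines/kato_Fframe_r4.lean` verbatim: at a SPLIT multiplicative `p ≥ 5`, `c_p = ord_p(Δ_min)`, and with
`p^t = #E(ℚ_p)[p^∞]` there are a point `Q₀` of order exactly `p^m`, `m := t`, and a point `Q` whose
logarithm generates `log_ω E(ℚ_p) = p^{1+t−v_p c_p} ℤ_p`, i.e. has valuation `1 − v_p(ord_p Δ_min) + m`.
[cite: SilvermanAEC2009, IV.6.4, VII.2.1, VII.3.1, VII.6.1] [cite: SilvermanATAEC1994, Cor. IV.9.2(d) with (b) (PDF p. 340)] -/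
theorem tateUniformisationLogMinimumTamagawa :
    ∀ (W : WeierstrassCurve ℚ) [W.IsElliptic] [W.IsGloballyMinimal] (p : ℕ) [Fact p.Prime],
      5 ≤ p → W.HasSplitMultiplicativeReductionAtPrime p →
      (W.baseChange ℚ_[p]).localTamagawaNumber ℤ_[p] = padicValInt p W.minimalDiscriminantInt ∧
      ∃ (m : ℕ) (Q₀ Q : (W.baseChange ℚ_[p]).toAffine.Point), addOrderOf Q₀ = p ^ m ∧
        padicLogLocal W p Q ≠ 0 ∧
        (padicLogLocal W p Q).valuation =
          1 - (padicValNat p (padicValInt p W.minimalDiscriminantInt) : ℤ) + m := by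
  intro W _ _ p _ h5 hsplit
  have hpP : p.Prime := Fact.out
  have hcp := localTamagawaNumber_padic_eq_padicValInt_of_split W p hsplit
  refine ⟨hcp, ?_⟩
  -- split multiplicative reduction of the chosen `ℤ_p`-minimal model, moved to the globally minimal `W ⊗ ℚ_p`
  have hs : ((W.baseChange ℚ_[p]).minimal ℤ_[p]).HasSplitMultiplicativeReduction ℤ_[p] := hsplit
  have hmult : W.HasMultiplicativeReductionAtPrime p := hs.toHasMultiplicativeReduction
  have hmin : (W.baseChange ℚ_[p]).minimal ℤ_[p] =
      ((W.baseChange ℚ_[p]).exists_isMinimal ℤ_[p]).choose • (W.baseChange ℚ_[p]) := rfl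
  have hsX : (W.baseChange ℚ_[p]).HasSplitMultiplicativeReduction ℤ_[p] :=
    (hasSplitMultiplicativeReduction_iff_of_isMinimal_of_eq_smul ℤ_[p] hmin
      (W.baseChange ℚ_[p]).isUnit_Δ.ne_zero).mp hs
  -- `p ∤ #Ẽ_ns(𝔽_p) = p − 1`
  have hn : ¬ p ∣ Nat.card ((W.baseChange ℚ_[p]).reduction ℤ_[p]).toAffine.Point := by
    have h := LocalTorsion.not_dvd_reductionPointCount_of_mult W p hmult
    rwa [← LocalTorsion.natCard_point_reduction_baseChange_padic W p] at h
  -- (c) the point of order `p^t`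
  obtain ⟨Q₀, hQ₀⟩ :=
    exists_addOrderOf_eq_pow_padicValNat_card_torsion (W.baseChange ℚ_[p]) (by omega) hn hsX
  -- (b) the generator of the image of `log`
  have hrange := LocalLog.range_padicLog_baseChange_of_mult W p hmult
  have hmem : (p : ℚ_[p]) ^ ((1 : ℤ) +
      padicValNat p (Nat.card (AddCommGroup.torsion (W.baseChange ℚ_[p]).toAffine.Point)) -
        padicValNat p ((W.baseChange ℚ_[p]).localTamagawaNumber ℤ_[p])) ∈
      (LocalLog.padicLog (W.baseChange ℚ_[p])).range := by
    rw [hrange]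
    exact Submodule.mem_span_singleton_self _
  obtain ⟨Q, hQ⟩ := AddMonoidHom.mem_range.mp hmem
  refine ⟨padicValNat p (Nat.card (AddCommGroup.torsion (W.baseChange ℚ_[p]).toAffine.Point)),
    Q₀, Q, hQ₀, ?_, ?_⟩
  · rw [padicLogLocal_eq_padicLog W p Q, hQ]
    exact zpow_ne_zero _ (Nat.cast_ne_zero.mpr hpP.ne_zero)
  · rw [padicLogLocal_eq_padicLog W p Q, hQ, Padic.valuation_zpow, Padic.valuation_p, mul_one, hcp]
    ring

end Summit.BirchSwinnertonDyer.BirchSwinnertonDyer.Cruxes.EulerHalfNotRamNoInertSetAtFive.KatoFframe.S2split
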